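import Mathlib
import Literature.AlgebraicGeometry.Resolution.NearPointsPointCentreLine
import Literature.AlgebraicGeometry.Resolution.BlowupChartRsop
import HarnessLib

/-!
# The line through a near point with `τ(x) = 1` is a regular curve germ there (CoP1, Lemma 4.3 (5); CJS, Def. 6.38 (ii))

Topic: `Literature/AlgebraicGeometry/Resolution`. Local structure of the projective line
`L_x = Proj(Dir_x(E)) ⊂ q⁻¹(x) ≃ ℙ²_{k(x)}` of Cossart–Piltant 2008, Lemma 4.3 (5) (p. 8: "those
points `x′ ∈ q⁻¹(x)` near `x` all lie on the projective line `L_x`") — the first centre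
`C₁ = ℙ(Dir_x(X)) ≅ ℙ¹_{k(x)}` of a fundamental unit of Cossart–Jannsen–Saito, LNM 2270, Def. 6.38 (ii),
blown up when its generic point is near — AT A NEAR POINT: in the words of the proof of CP Lemma 4.5
(2), p. 12, "`x′` has r.s.p. `(u′₁ := u₁, u′₂ := u₂/u₁, z′ := z/u₁)`" and the line is `V(z′, u₁′)`, a
REGULAR curve germ cut out by two members of a regular system of parameters — which is what makes
it an admissible blow-up centre and what the curve-chart laws (`CurveBlowupPolygonLaws`: centre
`V(y′, u₁)`) consume.

PROVED here (no facts, no definitions), completing `NearPointsPointCentreLine.lean` (which placed the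
near point on `E ∩ div(c_{j₀})′`): for the blowing up `π` of a locally Noetherian `X` along a centre
with `𝓘_{Y,x} = 𝔪_x = (c₀, c₁, c₂)`, `𝒪_{X,x}` regular of dimension `3`, and the coordinate form
`Y_{j₀}` in the directrix of `cl_μ(J_x)` (`τ(x) = 1`, adapted coordinates):

* `IsBlowup.exists_isRsopPart_line_of_isNear_point_of_proj_mem_directrix` — at every near point `x′`
  there are an index `j ≠ j₀` and an element `w ∈ 𝒪_{X′,x′}` (the germ of `c_{j₀}/c_j`) with
  `𝔪_x𝒪_{X′,x′} = (c_j)`, `c_{j₀} = c_j · w`, and **`(c_j, w)` PART OF A REGULAR SYSTEM OF PARAMETERS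
  of `𝒪_{X′,x′}`** (tree `IsRsopPart`, via de Jong's chart computation `isRsopPart_chartFamily_reesChart`);
  hence (`…_consequences`) the ideal `𝔩 = (c_j, w)` of the line germ is prime, `𝒪_{X′,x′}/𝔩` is a
  regular local ring, and `dim 𝒪_{X′,x′}/𝔩 + 2 = dim 𝒪_{X′,x′}`; `τ = 1` versions
  `…_of_stalkTau_eq_one`.

Not here: the line as a global closed subscheme of `X′` (closure of the generic point of a chart,
gluing of the two charts), its generic point and the dichotomy «generic point near or not».
AI-written; weaker than expert review.

## Sources

* V. Cossart, O. Piltant, J. Algebra 320 (2008) 1051–1082, Lemma 4.3 (5), p. 8; proof of Lemma 4.5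
  (2), p. 12. [CossartPiltant2008]
* V. Cossart, U. Jannsen, S. Saito, LNM 2270 (2020), Def. 6.38 (ii), Lemma 13.2 (3). [CossartJannsenSaito2020]
* A. J. de Jong, Publ. Math. IHÉS 83 (1996), 2.4. [DeJong1996]
-/

noncomputable section

open CategoryTheory AlgebraicGeometry TopologicalSpace IsLocalRing

namespace Literature.AlgebraicGeometry.Resolution

universe u

open Scheme.IdealSheafData

variable {X X' : Scheme.{u}} {π : X' ⟶ X}

set_option maxHeartbeats 400000 in
-- the chart presentation of the stalk elaborates large terms
/-- **The line germ at a near point over a `τ = 1` point is regular** ([CoP1] Lemma 4.3 (5) with the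
local structure of the chart, de Jong 2.4): `π` the blowing up of a locally Noetherian `X` along a
centre `Y` with `𝓘_{Y,x} = 𝔪_x = (c₀, c₁, c₂)` at `x = π x′`, `𝒪_{X,x}` regular of dimension `3`, the
coordinate form `Y_{j₀}` in the directrix of `cl_μ(J_x)`, `x′` near for `(J, μ)`. Then for some `j ≠ j₀`
and some `w ∈ 𝒪_{X′,x′}`: `𝔪_x 𝒪_{X′,x′} = (c_j)`, `c_{j₀} = c_j · w` (images under `π^♯`), and the pair
`(c_j, w)` — local equations of the exceptional divisor and of the strict transform of `div(c_{j₀})` —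
is part of a regular system of parameters of `𝒪_{X′,x′}`.
[cite: CossartPiltant2008, Lemma 4.3 (5)] [cite: DeJong1996, 2.4] -/
theorem IsBlowup.exists_isRsopPart_line_of_isNear_point_of_proj_mem_directrix [IsLocallyNoetherian X]
    [IsLocallyNoetherian X'] {Y : Closeds X} (hπ : IsBlowup π (vanishingIdeal Y))
    {J : X.IdealSheafData} {μ : ℕ} {x' : X'} [IsRegularLocalRing (X.presheaf.stalk (π x'))]
    (hd : (maximalIdeal (X.presheaf.stalk (π x'))).spanFinrank = 3)
    {c : Fin 3 → X.presheaf.stalk (π x')} (hc : Ideal.span (Set.range c) = maximalIdeal _)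
    (hcY : Ideal.span (Set.range c) = stalkIdeal (vanishingIdeal Y) (π x')) (j₀ : Fin 3)
    (hdir : (LinearMap.proj j₀ : Module.Dual (ResidueField (X.presheaf.stalk (π x')))
        (Fin 3 → ResidueField (X.presheaf.stalk (π x')))) ∈
      directrix (ResidueField (X.presheaf.stalk (π x')))
        (initialForms c (stalkIdeal J (π x')) μ :
          Set (MvPolynomial (Fin 3) (ResidueField (X.presheaf.stalk (π x'))))))
    (hnear : IsNear π (vanishingIdeal Y) J μ x') :
    ∃ (j : Fin 3) (w : X'.presheaf.stalk x'), j ≠ j₀ ∧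
      (maximalIdeal (X.presheaf.stalk (π x'))).map (π.stalkMap x').hom =
        Ideal.span {(π.stalkMap x').hom (c j)} ∧
      (π.stalkMap x').hom (c j₀) = (π.stalkMap x').hom (c j) * w ∧
      IsRsopPart ![(π.stalkMap x').hom (c j), w] := by
  classical
  obtain ⟨j, 𝔴, χ, hχ, hloc, h𝔴⟩ := hπ.exists_reesChart_stalk x' c hcY
  letI := χ.toAlgebra
  haveI : IsLocalization.AtPrime (X'.presheaf.stalk x') 𝔴.asIdeal := hloc
  have hχalg : ∀ b, algebraMap (chartRing c j) (X'.presheaf.stalk x') b = χ b := fun b =>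
    congrFun (congrArg DFunLike.coe (RingHom.algebraMap_toAlgebra χ)) b
  have h𝔴' : (maximalIdeal _).map (chartBase c j) ≤ 𝔴.asIdeal := by
    rw [← h𝔴]; exact Ideal.map_comap_le
  have hnearF : ∀ F : MvPolynomial (Fin 3) (X.presheaf.stalk (π x')), F.IsHomogeneous μ →
      MvPolynomial.eval c F ∈ stalkIdeal J (π x') →
      (algebraMap (chartRing c j) (Localization.AtPrime 𝔴.asIdeal) :
          chartRing c j →+* Localization.AtPrime 𝔴.asIdeal)
          (MvPolynomial.eval₂Hom (chartBase c j) (fun i => chartGen c j i) F) ∈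
        maximalIdeal (Localization.AtPrime 𝔴.asIdeal) ^ μ :=
    fun F hF hFJ => algebraMap_eval₂Hom_mem_pow_of_isNear hcY j 𝔴 χ hχ hloc hnear hF hFJ
  obtain ⟨hne, hmem⟩ :=
    ne_and_chartGen_mem_of_near_point_of_proj_mem_directrix hd c hc j j₀ 𝔴.asIdeal h𝔴' hnearF hdir
  -- `𝔪 B_j = (c_j)` in the stalk
  have hu : ∀ l, chartBase c j (c l) = chartBase c j (c j) * chartGen c j l :=
    fun l => reesChartBase_apply_eq_mul_chartGen c j l
  have hmapχ : (maximalIdeal (X.presheaf.stalk (π x'))).map (π.stalkMap x').hom =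
      Ideal.span {(π.stalkMap x').hom (c j)} := by
    have h1 : (π.stalkMap x').hom = χ.comp (chartBase c j) := RingHom.ext fun a => (hχ a).symm
    rw [h1, ← Ideal.map_map, ← hc, Ideal.map_span_range_eq_span_singleton _ c j _ hu, Ideal.map_span,
      Set.image_singleton, RingHom.comp_apply]
  -- de Jong's chart computation: `(c_j, e_{j₀})` is part of a regular system of parameters of the stalk
  have hz : Ideal.span (Set.range (Fin.append c Fin.elim0)) = maximalIdeal (X.presheaf.stalk (π x')) := by
    have hsurj : Function.Surjective (Fin.cast (Nat.add_zero 3) : Fin (3 + 0) → Fin 3) :=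
      (finCongr (Nat.add_zero 3)).surjective
    rw [Fin.append_elim0, hsurj.range_comp]
    exact hc
  let jJ : Fin 1 → {i : Fin 3 // i ≠ j} := fun _ => ⟨j₀, fun h => hne h.symm⟩
  have hjJ : Function.Injective jJ := Function.injective_of_subsingleton _
  have hfam := isRsopPart_chartFamily_reesChart c j Fin.elim0 hz (by rw [hd]) 𝔴.asIdeal h𝔴
    (X'.presheaf.stalk x') jJ hjJ (fun _ => hmem)
  have hfam_eq : chartFamily c j Fin.elim0 (X'.presheaf.stalk x') (chartBase c j) (chartGen c j) jJ =
      ![(π.stalkMap x').hom (c j), χ (chartGen c j j₀)] := by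
    funext i
    refine Fin.cases ?_ (fun k => ?_) i
    · simp only [chartFamily, Fin.cons_zero, Matrix.cons_val_zero]
      rw [hχalg, hχ]
    · simp only [chartFamily, Fin.cons_succ, Matrix.cons_val_succ, Matrix.cons_val_fin_one]
      rw [Fin.append_right_nil _ _ rfl, Function.comp_apply, hχalg]
  have hprod : (π.stalkMap x').hom (c j₀) = (π.stalkMap x').hom (c j) * χ (chartGen c j j₀) := by
    rw [← hχ (c j₀), ← hχ (c j), hu j₀, map_mul]
  rw [hfam_eq] at hfam
  exact ⟨j, χ (chartGen c j j₀), hne, hmapχ, hprod, hfam⟩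

/-- **Consequences at a near point**: the ideal `𝔩 = (c_j, c_{j₀}/c_j)` of the line germ is prime,
`𝒪_{X′,x′}/𝔩` is a regular local ring, and `dim (𝒪_{X′,x′}/𝔩) + 2 = dim 𝒪_{X′,x′}` (the line is a
regular curve germ through `x′`). [cite: CossartPiltant2008, Lemma 4.3 (5)] [cite: DeJong1996, 2.4] -/
theorem IsBlowup.exists_line_germ_of_isNear_point_of_proj_mem_directrix [IsLocallyNoetherian X]
    [IsLocallyNoetherian X'] {Y : Closeds X} (hπ : IsBlowup π (vanishingIdeal Y))
    {J : X.IdealSheafData} {μ : ℕ} {x' : X'} [IsRegularLocalRing (X.presheaf.stalk (π x'))]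
    (hd : (maximalIdeal (X.presheaf.stalk (π x'))).spanFinrank = 3)
    {c : Fin 3 → X.presheaf.stalk (π x')} (hc : Ideal.span (Set.range c) = maximalIdeal _)
    (hcY : Ideal.span (Set.range c) = stalkIdeal (vanishingIdeal Y) (π x')) (j₀ : Fin 3)
    (hdir : (LinearMap.proj j₀ : Module.Dual (ResidueField (X.presheaf.stalk (π x')))
        (Fin 3 → ResidueField (X.presheaf.stalk (π x')))) ∈
      directrix (ResidueField (X.presheaf.stalk (π x')))
        (initialForms c (stalkIdeal J (π x')) μ :
          Set (MvPolynomial (Fin 3) (ResidueField (X.presheaf.stalk (π x'))))))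
    (hnear : IsNear π (vanishingIdeal Y) J μ x') :
    ∃ (j : Fin 3) (w : X'.presheaf.stalk x'), j ≠ j₀ ∧
      (π.stalkMap x').hom (c j₀) = (π.stalkMap x').hom (c j) * w ∧
      (Ideal.span {(π.stalkMap x').hom (c j), w}).IsPrime ∧
      IsRegularLocalRing (X'.presheaf.stalk x' ⧸ Ideal.span {(π.stalkMap x').hom (c j), w}) ∧
      ringKrullDim (X'.presheaf.stalk x' ⧸ Ideal.span {(π.stalkMap x').hom (c j), w}) + 2 =
        ringKrullDim (X'.presheaf.stalk x') := by
  obtain ⟨j, w, hne, -, hw, hrsop⟩ :=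
    hπ.exists_isRsopPart_line_of_isNear_point_of_proj_mem_directrix hd hc hcY j₀ hdir hnear
  have hrange : Set.range ![(π.stalkMap x').hom (c j), w] = {(π.stalkMap x').hom (c j), w} := by
    rw [Matrix.range_cons, Matrix.range_cons, Matrix.range_empty, Set.union_empty]
    ext z; simp [or_comm]
  refine ⟨j, w, hne, hw, ?_, ?_, ?_⟩
  · have := hrsop.isPrime_span_range; rwa [hrange] at this
  · have := hrsop.isRegularLocalRing_quotient; rwa [hrange] at this
  · have := hrsop.ringKrullDim_quotient_add; rwa [hrange] at this

/-- **`τ = 1` version**: with `c` adapted at the indices `≠ j₀` (`T_x = k(x)·Y_{j₀}`), at every near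
point `x′` over `x` the pair `(c_j, c_{j₀}/c_j)` (some `j ≠ j₀`) is part of a regular system of
parameters of `𝒪_{X′,x′}`: the line `L_x` is a regular curve germ at each near point.
[cite: CossartPiltant2008, Lemma 4.3 (5)] -/
theorem IsBlowup.exists_isRsopPart_line_of_isNear_point_of_stalkTau_eq_one [IsLocallyNoetherian X]
    [IsLocallyNoetherian X'] {Y : Closeds X} (hπ : IsBlowup π (vanishingIdeal Y))
    {J : X.IdealSheafData} {μ : ℕ} {x' : X'} [IsRegularLocalRing (X.presheaf.stalk (π x'))]
    (hd : (maximalIdeal (X.presheaf.stalk (π x'))).spanFinrank = 3)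
    {c : Fin 3 → X.presheaf.stalk (π x')} (hc : Ideal.span (Set.range c) = maximalIdeal _)
    (hcY : Ideal.span (Set.range c) = stalkIdeal (vanishingIdeal Y) (π x')) (j₀ : Fin 3)
    (hτ : stalkTau J (π x') μ = 1) (had : ∀ i, i ≠ j₀ → IsAdapted c (stalkIdeal J (π x')) μ i)
    (hnear : IsNear π (vanishingIdeal Y) J μ x') :
    ∃ (j : Fin 3) (w : X'.presheaf.stalk x'), j ≠ j₀ ∧
      (maximalIdeal (X.presheaf.stalk (π x'))).map (π.stalkMap x').hom =
        Ideal.span {(π.stalkMap x').hom (c j)} ∧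
      (π.stalkMap x').hom (c j₀) = (π.stalkMap x').hom (c j) * w ∧
      IsRsopPart ![(π.stalkMap x').hom (c j), w] := by
  have hτc : hironakaTauAt c (stalkIdeal J (π x')) μ = 1 := by
    rw [← stalkTau_eq J (π x') μ hd c hc]; exact hτ
  exact hπ.exists_isRsopPart_line_of_isNear_point_of_proj_mem_directrix hd hc hcY j₀
    (proj_mem_directrix_of_hironakaTauAt_eq_one c j₀ hτc had) hnear

end Literature.AlgebraicGeometry.Resolution

end
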